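import Summits.FinalStateConjecture.FinalStateConjecture.Theorems.ClusterCompletenessAdiabaticMultiKerrILEDPerforatedHardyCutoff
import Summits.FinalStateConjecture.FinalStateConjecture.Theorems.ClusterCompletenessAdiabaticMultiKerrILEDPerforatedHardyPoincare

/-!
# Route ClusterCompleteness — crux `AdiabaticMultiKerrILED`, line `Sketch`: perforated Hardy
# inequality, part 3: the Poincaré inequality on the cubical shell around one hole

Helper file for the crux `stmt-FinalStateConjecture-14310`
(`Summit.FinalStateConjecture.FinalStateConjecture.Theses.ClusterCompleteness.AdiabaticMultiKerrILED`),
stub `stub_perforatedHardy`.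

For a hole `B(c, ρ)` the extension of `φ` used in the perforated Hardy inequality is modified on
the cubical shell `T = {1.1 ρ ≤ ‖y − c‖_∞ ≤ 1.15 ρ}`. Here we prove
`shell_poincare`: for `φ` of class `C¹` on the annulus `N = {ρ < |y − c| < 4ρ}` there is a
constant `m` with `∫_T (φ − m)² ≤ C ρ² ∫_N ‖Dφ‖²`, `C = 4210701 · 144/25`. Proof: `T` is covered
by six side cubes of side `2.4 ρ` lying in `N` (one per face), each carrying its Poincaré
inequality (`poincare_localCube`: the cube inequality `poincare_coordBox` applied to `χ φ` for a
cubical bump `χ`); consecutive cubes overlap in boxes of volume `1/256` of a cube, so the six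
local constants are glued to the constant of a hub cube (`glue_const`), in two generations.

Folklore. [folklore]
-/

noncomputable section

-- the doubled `FinalStateConjecture.FinalStateConjecture` path component trips dupNamespace
set_option linter.dupNamespace false

open Literature.Geometry.Lorentzian MeasureTheory Set Filter Metric
open scoped Topology ENNReal

namespace Summit.FinalStateConjecture.FinalStateConjecture.Cruxes.AdiabaticMultiKerrILED.Sketch

/-- **Poincaré inequality on a cube for a locally `C¹` function.** If `φ` is `C¹` at every
point of the closed box `[p − δ, p + ℓ + δ]` (`ℓ, δ > 0`), then for some constant `M`,
`∫_{(p, p+ℓ)} (φ − M)² ≤ ℓ² ∫_{(p, p+ℓ)} ‖Dφ‖²` (apply `poincare_coordBox` to `χ φ`, `χ` a cubical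
bump equal to `1` near the cube and supported in the enlarged box). [folklore] -/
theorem poincare_localCube {φ : E3 → ℝ} (p : Fin 3 → ℝ) {ℓ δ : ℝ} (hℓ : 0 < ℓ) (hδ : 0 < δ)
    (hφ : ∀ y : E3, (∀ k, y k ∈ Icc (p k - δ) (p k + ℓ + δ)) → ContDiffAt ℝ 1 φ y) :
    ∃ M : ℝ, ∫⁻ y in {y : E3 | ∀ k, y k ∈ Ioo (p k) (p k + ℓ)}, ENNReal.ofReal ((φ y - M) ^ 2) ≤
      ENNReal.ofReal (ℓ ^ 2) *
        ∫⁻ y in {y : E3 | ∀ k, y k ∈ Ioo (p k) (p k + ℓ)}, ENNReal.ofReal (‖fderiv ℝ φ y‖ ^ 2) := by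
  -- the cubical bump `χ`
  obtain ⟨D, -, hcube⟩ := exists_cube_plateau
  set z : Fin 3 → ℝ := fun k => p k + ℓ / 2 with hz
  set A : ℝ := ℓ / 2 + δ / 3 with hA
  set B : ℝ := ℓ / 2 + 2 * δ / 3 with hB
  have hAB : A < B := by rw [hA, hB]; linarith
  obtain ⟨χ, hχC, -, hχone, hχzero, -⟩ := hcube z 1 A B one_pos hAB
  have hχ1 : ∀ y : E3, (∀ k, y k ∈ Ioo (p k) (p k + ℓ)) → χ =ᶠ[𝓝 y] fun _ => 1 := by
    intro y hy
    refine hχone y fun k => ?_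
    obtain ⟨h1, h2⟩ := hy k
    rw [mul_one, abs_lt, hz, hA]
    constructor <;> dsimp only <;> linarith
  have hχ0 : ∀ y : E3, (¬ ∀ k, y k ∈ Icc (p k - δ) (p k + ℓ + δ)) →
      χ =ᶠ[𝓝 y] fun _ => 0 := by
    intro y hy
    refine hχzero y ?_
    simp only [not_forall] at hy
    obtain ⟨k, hk⟩ := hy
    refine ⟨k, ?_⟩
    rw [mul_one, hz, hB, lt_abs]
    dsimp only
    by_cases h1 : p k - δ ≤ y k
    · have h2 : ¬ y k ≤ p k + ℓ + δ := fun h2 => hk ⟨h1, h2⟩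
      left; linarith [lt_of_not_ge h2]
    · right; linarith [lt_of_not_ge h1]
  -- `g = χ φ ∈ C¹_c`
  set g : E3 → ℝ := fun y => χ y * φ y with hg
  have hgC : ContDiff ℝ 1 g := by
    rw [contDiff_iff_contDiffAt]
    intro y
    by_cases hy : ∀ k, y k ∈ Icc (p k - δ) (p k + ℓ + δ)
    · exact hχC.contDiffAt.mul (hφ y hy)
    · have hev : g =ᶠ[𝓝 y] fun _ => 0 := by
        filter_upwards [hχ0 y hy] with w hw
        simp [hg, hw]
      exact contDiffAt_const.congr_of_eventuallyEq hev
  have hgsupp : HasCompactSupport g := by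
    refine HasCompactSupport.intro
      (isCompact_coordBox (fun k => p k - δ) (fun k => p k + ℓ + δ)) fun y hy => ?_
    have h0 : χ y = 0 := (hχ0 y hy).self_of_nhds
    simp [hg, h0]
  -- on the cube `g = φ` to first order
  have hgeq : ∀ y ∈ {y : E3 | ∀ k, y k ∈ Ioo (p k) (p k + ℓ)}, g y = φ y := fun y hy => by
    have h1 : χ y = 1 := (hχ1 y hy).self_of_nhds
    simp [hg, h1]
  have hgDeq : ∀ y ∈ {y : E3 | ∀ k, y k ∈ Ioo (p k) (p k + ℓ)}, fderiv ℝ g y = fderiv ℝ φ y :=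
    fun y hy => by
    have hev : g =ᶠ[𝓝 y] φ := by
      filter_upwards [hχ1 y hy] with w hw
      simp [hg, hw]
    exact hev.fderiv_eq
  obtain ⟨M, hM⟩ := poincare_coordBox g p ℓ hℓ hgC hgsupp
  refine ⟨M, ?_⟩
  have hmeas : MeasurableSet {y : E3 | ∀ k, y k ∈ Ioo (p k) (p k + ℓ)} :=
    (isOpen_coordBox p fun k => p k + ℓ).measurableSet
  calc ∫⁻ y in {y : E3 | ∀ k, y k ∈ Ioo (p k) (p k + ℓ)}, ENNReal.ofReal ((φ y - M) ^ 2)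
      = ∫⁻ y in {y : E3 | ∀ k, y k ∈ Ioo (p k) (p k + ℓ)}, ENNReal.ofReal ((g y - M) ^ 2) :=
        setLIntegral_congr_fun hmeas fun y hy => by rw [hgeq y hy]
    _ ≤ _ := hM
    _ = _ := by rw [setLIntegral_congr_fun hmeas fun y hy => by rw [hgDeq y hy]]

/-! ### Geometry of the six side cubes (tables passed as hypotheses) -/

/-- The `ρ/40`-enlarged side cubes lie in the annulus `{ρ < |y − c| < 4ρ}`. [folklore] -/
theorem enlargedSideCube_subset_annulus (c : E3) {ρ : ℝ} (hρ : 0 < ρ) (lo : Fin 6 → Fin 3 → ℝ)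
    (hlo : lo = ![![-6 / 5, 21 / 20, -6 / 5], ![21 / 20, -6 / 5, -6 / 5], ![-69 / 20, -6 / 5, -6 / 5],
        ![-6 / 5, -6 / 5, 21 / 20], ![-6 / 5, -6 / 5, -69 / 20], ![-6 / 5, -69 / 20, -6 / 5]])
    (j : Fin 6) (y : E3)
    (hy : ∀ i, y i ∈ Icc (c i + ρ * lo j i - ρ / 40) (c i + ρ * lo j i + 12 / 5 * ρ + ρ / 40)) :
    ρ < dist y c ∧ dist y c < 4 * ρ := by
  have h0 := hy 0; have h1 := hy 1; have h2 := hy 2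
  simp only [hlo, mem_Icc] at h0 h1 h2
  have key : ∀ r : Fin 3 → ℝ, (∀ k, |y k - c k| ≤ r k) → ∑ k, r k ^ 2 < (4 * ρ) ^ 2 →
      dist y c < 4 * ρ := fun r hr hlt =>
    (pow_lt_pow_iff_left₀ dist_nonneg (by linarith) two_ne_zero).1
      ((dist_sq_le_of_abs_le c hr).trans_lt hlt)
  have low : ∀ k, ρ < |y k - c k| → ρ < dist y c := fun k hk =>
    hk.trans_le (abs_sub_apply_le_dist c y k)
  fin_cases j <;>
    simp only [Fin.zero_eta, Fin.isValue, Fin.mk_one, Fin.reduceFinMk, Matrix.cons_val_zero,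
      Matrix.cons_val_one, Matrix.cons_val] at h0 h1 h2
  · refine ⟨low 1 (by rw [lt_abs]; left; linarith),
      key ![49 / 40 * ρ, 139 / 40 * ρ, 49 / 40 * ρ] (fun k => ?_) ?_⟩
    · fin_cases k <;> simp [abs_le] <;> constructor <;> linarith
    · simp [Fin.sum_univ_three]; nlinarith
  · refine ⟨low 0 (by rw [lt_abs]; left; linarith),
      key ![139 / 40 * ρ, 49 / 40 * ρ, 49 / 40 * ρ] (fun k => ?_) ?_⟩
    · fin_cases k <;> simp [abs_le] <;> constructor <;> linarith
    · simp [Fin.sum_univ_three]; nlinarith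
  · refine ⟨low 0 (by rw [lt_abs]; right; linarith),
      key ![139 / 40 * ρ, 49 / 40 * ρ, 49 / 40 * ρ] (fun k => ?_) ?_⟩
    · fin_cases k <;> simp [abs_le] <;> constructor <;> linarith
    · simp [Fin.sum_univ_three]; nlinarith
  · refine ⟨low 2 (by rw [lt_abs]; left; linarith),
      key ![49 / 40 * ρ, 49 / 40 * ρ, 139 / 40 * ρ] (fun k => ?_) ?_⟩
    · fin_cases k <;> simp [abs_le] <;> constructor <;> linarith
    · simp [Fin.sum_univ_three]; nlinarith
  · refine ⟨low 2 (by rw [lt_abs]; right; linarith),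
      key ![49 / 40 * ρ, 49 / 40 * ρ, 139 / 40 * ρ] (fun k => ?_) ?_⟩
    · fin_cases k <;> simp [abs_le] <;> constructor <;> linarith
    · simp [Fin.sum_univ_three]; nlinarith
  · refine ⟨low 1 (by rw [lt_abs]; right; linarith),
      key ![49 / 40 * ρ, 139 / 40 * ρ, 49 / 40 * ρ] (fun k => ?_) ?_⟩
    · fin_cases k <;> simp [abs_le] <;> constructor <;> linarith
    · simp [Fin.sum_univ_three]; nlinarith

/-- The six side cubes cover the cubical shell. [folklore] -/
theorem cubeShell_subset_sideCubes (c : E3) {ρ : ℝ} (hρ : 0 < ρ) (lo : Fin 6 → Fin 3 → ℝ)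
    (hlo : lo = ![![-6 / 5, 21 / 20, -6 / 5], ![21 / 20, -6 / 5, -6 / 5], ![-69 / 20, -6 / 5, -6 / 5],
        ![-6 / 5, -6 / 5, 21 / 20], ![-6 / 5, -6 / 5, -69 / 20], ![-6 / 5, -69 / 20, -6 / 5]])
    (y : E3) (hb : ∀ k, |y k - c k| ≤ 23 / 20 * ρ) (ha : ¬ ∀ k, |y k - c k| < 11 / 10 * ρ) :
    ∃ j, ∀ i, y i ∈ Ioo (c i + ρ * lo j i) (c i + ρ * lo j i + 12 / 5 * ρ) := by
  simp only [not_forall, not_lt] at ha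
  obtain ⟨k, hk⟩ := ha
  have hb0 := abs_le.1 (hb 0); have hb1 := abs_le.1 (hb 1); have hb2 := abs_le.1 (hb 2)
  have aux : ∀ j : Fin 6, (∀ i, y i ∈ Ioo (c i + ρ * lo j i) (c i + ρ * lo j i + 12 / 5 * ρ)) →
      ∃ j, ∀ i, y i ∈ Ioo (c i + ρ * lo j i) (c i + ρ * lo j i + 12 / 5 * ρ) := fun j h => ⟨j, h⟩
  subst hlo
  fin_cases k <;> simp only [Fin.zero_eta, Fin.isValue, Fin.mk_one, Fin.reduceFinMk] at hk
  · rcases le_abs'.1 hk with h | h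
    · refine aux 2 fun i => ?_
      fin_cases i <;> simp <;> constructor <;> linarith
    · refine aux 1 fun i => ?_
      fin_cases i <;> simp <;> constructor <;> linarith
  · rcases le_abs'.1 hk with h | h
    · refine aux 5 fun i => ?_
      fin_cases i <;> simp <;> constructor <;> linarith
    · refine aux 0 fun i => ?_
      fin_cases i <;> simp <;> constructor <;> linarith
  · rcases le_abs'.1 hk with h | h
    · refine aux 4 fun i => ?_
      fin_cases i <;> simp <;> constructor <;> linarith
    · refine aux 3 fun i => ?_
      fin_cases i <;> simp <;> constructor <;> linarith

/-- The five overlap boxes lie in their source cubes (`0, 0, 0, 0, 1`) and target cubes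
(`1, 2, 3, 4, 5`). [folklore] -/
theorem overlap_subset_sideCubes (c : E3) {ρ : ℝ} (lo : Fin 6 → Fin 3 → ℝ)
    (olo ohi : Fin 5 → Fin 3 → ℝ) (src dst : Fin 5 → Fin 6)
    (hlo : lo = ![![-6 / 5, 21 / 20, -6 / 5], ![21 / 20, -6 / 5, -6 / 5], ![-69 / 20, -6 / 5, -6 / 5],
        ![-6 / 5, -6 / 5, 21 / 20], ![-6 / 5, -6 / 5, -69 / 20], ![-6 / 5, -69 / 20, -6 / 5]])
    (holo : olo = ![![21 / 20, 21 / 20, -6 / 5], ![-6 / 5, 21 / 20, -6 / 5], ![-6 / 5, 21 / 20, 21 / 20],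
        ![-6 / 5, 21 / 20, -6 / 5], ![21 / 20, -6 / 5, -6 / 5]])
    (hohi : ohi = ![![6 / 5, 6 / 5, 6 / 5], ![-21 / 20, 6 / 5, 6 / 5], ![6 / 5, 6 / 5, 6 / 5],
        ![6 / 5, 6 / 5, -21 / 20], ![6 / 5, -21 / 20, 6 / 5]])
    (hsrc : src = ![0, 0, 0, 0, 1]) (hdst : dst = ![1, 2, 3, 4, 5]) (j : Fin 5) (y : E3)
    (hy : ∀ i, y i ∈ Ioo (c i + ρ * olo j i) (c i + ρ * ohi j i)) :
    (∀ i, y i ∈ Ioo (c i + ρ * lo (src j) i) (c i + ρ * lo (src j) i + 12 / 5 * ρ)) ∧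
      ∀ i, y i ∈ Ioo (c i + ρ * lo (dst j) i) (c i + ρ * lo (dst j) i + 12 / 5 * ρ) := by
  subst hlo holo hohi hsrc hdst
  constructor <;> intro i <;> have h := hy i <;> fin_cases j <;> fin_cases i <;>
    simp at h ⊢ <;> constructor <;> linarith

/-- **Poincaré inequality on the cubical shell around a hole.** If `φ` is `C¹` at every point
of the annulus `{ρ < |y − c| < 4ρ}`, then for some constant `m`,
`∫_T (φ − m)² ≤ C ρ² ∫_{ρ<|y−c|<4ρ} ‖Dφ‖²` with `T` the cubical shell
`{‖y − c‖_∞ ≤ (23/20)ρ} ∖ {‖y − c‖_∞ < (11/10)ρ}` and `C = 4210701 · (144/25)`. [folklore] -/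
theorem shell_poincare :
    ∀ (c : E3) (ρ : ℝ), 0 < ρ → ∀ φ : E3 → ℝ,
      (∀ y : E3, ρ < dist y c → dist y c < 4 * ρ → ContDiffAt ℝ 1 φ y) →
      ∃ m : ℝ, ∫⁻ y in {y : E3 | (∀ k, |y k - c k| ≤ 23 / 20 * ρ) ∧ ¬ ∀ k, |y k - c k| < 11 / 10 * ρ},
          ENNReal.ofReal ((φ y - m) ^ 2) ≤
        ENNReal.ofReal (4210701 * (144 / 25) * ρ ^ 2) *
          ∫⁻ y in {y : E3 | ρ < dist y c ∧ dist y c < 4 * ρ}, ENNReal.ofReal (‖fderiv ℝ φ y‖ ^ 2) := by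
  intro c ρ hρ φ hφ
  -- notation: shell, annulus, side cubes, overlaps
  set T : Set E3 := {y | (∀ k, |y k - c k| ≤ 23 / 20 * ρ) ∧ ¬ ∀ k, |y k - c k| < 11 / 10 * ρ}
    with hT
  set N : Set E3 := {y | ρ < dist y c ∧ dist y c < 4 * ρ} with hN
  obtain ⟨lo, hlo⟩ : ∃ lo : Fin 6 → Fin 3 → ℝ, lo =
      ![![-6 / 5, 21 / 20, -6 / 5], ![21 / 20, -6 / 5, -6 / 5], ![-69 / 20, -6 / 5, -6 / 5],
        ![-6 / 5, -6 / 5, 21 / 20], ![-6 / 5, -6 / 5, -69 / 20], ![-6 / 5, -69 / 20, -6 / 5]] := ⟨_, rfl⟩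
  obtain ⟨olo, holo⟩ : ∃ olo : Fin 5 → Fin 3 → ℝ, olo =
      ![![21 / 20, 21 / 20, -6 / 5], ![-6 / 5, 21 / 20, -6 / 5], ![-6 / 5, 21 / 20, 21 / 20],
        ![-6 / 5, 21 / 20, -6 / 5], ![21 / 20, -6 / 5, -6 / 5]] := ⟨_, rfl⟩
  obtain ⟨ohi, hohi⟩ : ∃ ohi : Fin 5 → Fin 3 → ℝ, ohi =
      ![![6 / 5, 6 / 5, 6 / 5], ![-21 / 20, 6 / 5, 6 / 5], ![6 / 5, 6 / 5, 6 / 5],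
        ![6 / 5, 6 / 5, -21 / 20], ![6 / 5, -21 / 20, 6 / 5]] := ⟨_, rfl⟩
  set cor : Fin 6 → Fin 3 → ℝ := fun j i => c i + ρ * lo j i with hcor
  set Q : Fin 6 → Set E3 := fun j => {y | ∀ i, y i ∈ Ioo (cor j i) (cor j i + 12 / 5 * ρ)} with hQ
  set O : Fin 5 → Set E3 := fun j => {y | ∀ i, y i ∈ Ioo (c i + ρ * olo j i) (c i + ρ * ohi j i)}
    with hO
  -- geometry of the cover
  have henl : ∀ (j : Fin 6) (y : E3),
      (∀ i, y i ∈ Icc (cor j i - ρ / 40) (cor j i + 12 / 5 * ρ + ρ / 40)) → y ∈ N :=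
    fun j y hy => enlargedSideCube_subset_annulus c hρ lo hlo j y hy
  have hQN : ∀ j, Q j ⊆ N := fun j y hy => henl j y fun i => by
    have h := hy i
    simp only [mem_Ioo] at h
    constructor <;> linarith [h.1, h.2]
  have hcover : T ⊆ ⋃ j, Q j := fun y hy =>
    mem_iUnion.2 (cubeShell_subset_sideCubes c hρ lo hlo y hy.1 hy.2)
  have hOsub : ∀ j : Fin 5, O j ⊆ Q (![0, 0, 0, 0, 1] j) ∧ O j ⊆ Q (![1, 2, 3, 4, 5] j) := fun j =>
    ⟨fun y hy => (overlap_subset_sideCubes c lo olo ohi _ _ hlo holo hohi rfl rfl j y hy).1,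
      fun y hy => (overlap_subset_sideCubes c lo olo ohi _ _ hlo holo hohi rfl rfl j y hy).2⟩
  -- volumes: a side cube has `256` times the volume of an overlap box
  have hvolQ : ∀ j, volume (Q j) = ENNReal.ofReal ((12 / 5 * ρ) ^ 3) := fun j => by
    simp only [hQ]
    rw [volume_coordBox, Fin.prod_univ_three]
    simp only [add_sub_cancel_left]
    rw [← ENNReal.ofReal_mul (by positivity), ← ENNReal.ofReal_mul (by positivity)]
    congr 1; ring
  have hvolO : ∀ j, volume (O j) = ENNReal.ofReal (27 / 500 * ρ ^ 3) := fun j => by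
    simp only [hO]
    rw [volume_coordBox, Fin.prod_univ_three]
    fin_cases j <;> simp [holo, hohi] <;>
      rw [← ENNReal.ofReal_mul (by linarith), ← ENNReal.ofReal_mul (by nlinarith)] <;>
      congr 1 <;> ring
  have hvol : ∀ (j : Fin 6) (j' : Fin 5), volume (Q j) ≤ 256 * volume (O j') := fun j j' => by
    rw [hvolQ, hvolO, show (256 : ℝ≥0∞) = ENNReal.ofReal 256 by simp,
      ← ENNReal.ofReal_mul (by norm_num)]
    exact ENNReal.ofReal_le_ofReal (le_of_eq (by ring))
  -- notation for the estimate
  set G : ℝ≥0∞ := ∫⁻ y in N, ENNReal.ofReal (‖fderiv ℝ φ y‖ ^ 2) with hG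
  set ℓ : ℝ := 12 / 5 * ρ with hℓ
  have hℓpos : 0 < ℓ := by rw [hℓ]; positivity
  set P : ℝ≥0∞ := ENNReal.ofReal (ℓ ^ 2) * G with hP
  set V : Set E3 → ℝ → ℝ≥0∞ := fun S m => ∫⁻ y in S, ENNReal.ofReal ((φ y - m) ^ 2) with hV
  -- the local Poincaré inequalities
  have hloc : ∀ j : Fin 6, ∃ M : ℝ, V (Q j) M ≤ P := by
    intro j
    obtain ⟨M, hM⟩ := poincare_localCube (φ := φ) (cor j) hℓpos (δ := ρ / 40) (by positivity)
      (fun y hy => by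
        have hyN := henl j y hy
        exact hφ y hyN.1 hyN.2)
    refine ⟨M, hM.trans ?_⟩
    rw [hP]
    gcongr
    exact lintegral_mono_set (hQN j)
  choose M hM using hloc
  -- measurability of `φ` on the overlaps
  have hNo : IsOpen N :=
    (isOpen_lt continuous_const (continuous_id.dist continuous_const)).inter
      (isOpen_lt (continuous_id.dist continuous_const) continuous_const)
  have hcont : ContinuousOn φ N := fun y hy => (hφ y hy.1 hy.2).continuousAt.continuousWithinAt
  have hφO : ∀ j : Fin 5, AEMeasurable φ (volume.restrict (O j)) := fun j =>
    (hcont.aemeasurable hNo.measurableSet).mono_set (((hOsub j).1).trans (hQN _))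
  -- generation one: cubes 1..4 against the hub `0`
  have hgen1 : ∀ j : Fin 5, (j : ℕ) < 4 →
      V (Q (![1, 2, 3, 4, 5] j)) (M 0) ≤ 2050 * P := by
    intro j hj
    have hs : (![0, 0, 0, 0, 1] : Fin 5 → Fin 6) j = 0 := by fin_cases j <;> simp at hj ⊢
    have h := glue_const (hOsub j).1 (hOsub j).2 (hφO j) (hvol (![1, 2, 3, 4, 5] j) j)
      (M (![0, 0, 0, 0, 1] j)) (M (![1, 2, 3, 4, 5] j))
    rw [hs] at h
    calc _ ≤ (2 + 4 * 256) * V (Q (![1, 2, 3, 4, 5] j)) (M (![1, 2, 3, 4, 5] j)) +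
        4 * 256 * V (Q 0) (M 0) := h
      _ ≤ (2 + 4 * 256) * P + 4 * 256 * P := by gcongr <;> apply hM
      _ = 2050 * P := by ring
  -- generation two: cube 5 against cube 1
  have hgen2 : V (Q 5) (M 0) ≤ 2050 * 2050 * P := by
    have h51 : V (Q 5) (M 1) ≤ 2050 * P := by
      have h := glue_const (hOsub 4).1 (hOsub 4).2 (hφO 4) (hvol 5 4) (M 1) (M 5)
      calc _ ≤ (2 + 4 * 256) * V (Q 5) (M 5) + 4 * 256 * V (Q 1) (M 1) := h
        _ ≤ (2 + 4 * 256) * P + 4 * 256 * P := by gcongr <;> apply hM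
        _ = 2050 * P := by ring
    have h10 : V (Q 1) (M 0) ≤ 2050 * P := hgen1 0 (by norm_num)
    have h := glue_const (hOsub 4).1 (hOsub 4).2 (hφO 4) (hvol 5 4) (M 0) (M 1)
    calc _ ≤ (2 + 4 * 256) * V (Q 5) (M 1) + 4 * 256 * V (Q 1) (M 0) := h
      _ ≤ (2 + 4 * 256) * (2050 * P) + 4 * 256 * (2050 * P) := by gcongr
      _ = 2050 * 2050 * P := by ring
  -- sum over the cover
  refine ⟨M 0, ?_⟩
  have hsum : V T (M 0) ≤ ∑ j : Fin 6, V (Q j) (M 0) := by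
    calc V T (M 0) ≤ V (⋃ j, Q j) (M 0) := lintegral_mono_set hcover
      _ ≤ ∑' j, V (Q j) (M 0) := lintegral_iUnion_le _ _
      _ = ∑ j : Fin 6, V (Q j) (M 0) := tsum_fintype _
  have h1 : V (Q 1) (M 0) ≤ 2050 * P := hgen1 0 (by norm_num)
  have h2 : V (Q 2) (M 0) ≤ 2050 * P := hgen1 1 (by norm_num)
  have h3 : V (Q 3) (M 0) ≤ 2050 * P := hgen1 2 (by norm_num)
  have h4 : V (Q 4) (M 0) ≤ 2050 * P := hgen1 3 (by norm_num)
  have hconst : ENNReal.ofReal (4210701 * (144 / 25) * ρ ^ 2) = 4210701 * ENNReal.ofReal (ℓ ^ 2) := by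
    rw [show (4210701 : ℝ≥0∞) = ENNReal.ofReal 4210701 by simp, ← ENNReal.ofReal_mul (by norm_num),
      hℓ]
    congr 1; ring
  calc V T (M 0) ≤ ∑ j : Fin 6, V (Q j) (M 0) := hsum
    _ = V (Q 0) (M 0) + V (Q 1) (M 0) + V (Q 2) (M 0) + V (Q 3) (M 0) + V (Q 4) (M 0) +
          V (Q 5) (M 0) := by
        simp only [Fin.sum_univ_succ, Fin.sum_univ_zero]; simp [add_assoc]
    _ ≤ P + 2050 * P + 2050 * P + 2050 * P + 2050 * P + 2050 * 2050 * P := by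
        gcongr
        exact hM 0
    _ = 4210701 * P := by ring
    _ = ENNReal.ofReal (4210701 * (144 / 25) * ρ ^ 2) * G := by rw [hconst, hP, mul_assoc]

end Summit.FinalStateConjecture.FinalStateConjecture.Cruxes.AdiabaticMultiKerrILED.Sketch

end
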